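import Summits.QuantumFields.QCD.Theses.ChiralSpinWaves
import HarnessLib.Audit

/-!
# Birth skeleton (BC3) for the crux `SpinWaveLaws` (item stmt-QuantumFields-16581)

Route `ChiralSpinWaves` (sub-problem QCD), crux decl
`Summit.QuantumFields.QCD.Theses.ChiralSpinWaves.SpinWaveLaws` (rev 4; rank 2; "the engine": pions are spin
waves — the SU(2) and SU(3) principal chiral models on `ℤ⁴` at low temperature `β` in a field `h` cluster
exponentially at the spin-wave mass `√(h/β)`, TWO-SIDEDLY — an upper bound for all bounded cylinder observables
and a lower bound for the transverse two-point function — uniformly in the volume of the torus `(ℤ/L)⁴`).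

Registered by the skeleton-registrar seat `planner-skel-stmt-QuantumFields-16581-0` (route re-audit bin
REPAIRABLE, 2026-08-17) as `Cruxes/SpinWaveLaws/Lines/birth.lean`.  It is the route-level BIRTH CERTIFICATE of
the crux (≥ 2 named stubs, a kernel-checked composition concluding the crux BY NAME, `sorry` only inside
`stub_*`), deliberately LINE-NEUTRAL: it cuts the crux along the route header's own two-layer plan for it
("SpinWaveLaws ⇐ SU(2) case (import the N-vector S³ results) → SU(3) case (group-valued rebuild)") crossed with
the header's stated two-sidedness risk ("the lower law needs transverse positivity at all distances"), i.e. the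
2 × 2 grid  {target SU(2) = S³ (the O(4) vector model) | target SU(3) (genuinely group-valued)} ×
{UPPER clustering law (Bałaban low-temperature expansion output) | LOWER transverse law (Goldstone-mode
propagation: infrared bounds / reflection positivity / correlation-function asymptotics)}:

* `stub_su2UpperClustering : UpperClustering 2` — O(4)-vector model on `(ℤ/L)⁴` in a field: truncated
  correlations of bounded cylinder observables decay like `K(|A|,|B|)·exp(−c√(h/β)·R)`, uniformly in `L`, for
  `β ≥ β₀`, `0 < h ≤ h₀` (size XL; nearest print: Bałaban 1995/96/98 low-T expansion, `h → 0⁺` regime).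
* `stub_su2TransverseLower : TransverseLower 2` — same model: the transverse two-point function is bounded BELOW
  by the spin-wave profile `(c'/β)(1+|y|)⁻² exp(−C√(h/β)|y|)` out to a quarter of the torus (size L–XL; nearest
  print: Bałaban–O'Carroll 1999 asymptotics, Fröhlich–Simon–Spencer 1976 infrared bounds, Giuliani–Ott 2023).
* `stub_su3UpperClustering : UpperClustering 3` — the SU(3) principal chiral model: the same upper law (size XL,
  open: the low-T expansion has to be rebuilt for a group-valued field, `π₃(SU(3)) = ℤ` textures).
* `stub_su3TransverseLower : TransverseLower 3` — the SU(3) principal chiral model: the same lower law (size XL).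

`SpinWaveLaws_of : (S1) → (S2) → (S3) → (S4) → SpinWaveLaws` is kernel-checked: case on `N ∈ {2,3}`, then
`lawsAt_of_upper_of_lower` merges the two one-sided threshold packages (`β₀ := max`, `h₀ := min`, `L₀ := max`;
the one-sided laws are monotone in their thresholds because they are universally quantified above them) and
identifies the named currency of §0 (`torusDist`, `pcmWeight`, `pcmMeasure`, `pcmExpect`, `transverse`) with the
crux's inlined `let`s DEFINITIONALLY (`LawsAt N hN` is the crux body verbatim).  `spinWaveLaws_of_stubs :
SpinWaveLaws` instantiates it.  The seam is bookkeeping by design (a birth certificate, not a line): all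
mathematical content sits in the four stubs, none of which gives the crux (each is one target × one side) or
the summit `QCD` on its own (BC3 probes, below).

## Negative knowledge honoured (read 2026-08-17)
* `Cruxes/SpinWaveLaws/` had NO workfiles before this one (`ledger crux ls`: no `Disproof.lean`, no dead lines,
  no ideas); the item's only evidence is the grounder note (NEW: no printed fixed-`h > 0` two-sided `√(h/β)` law
  for O(4) or SU(3); Bałaban–O'Carroll 1999 = `h → 0⁺` power-law regime per zbl 0932.81024; acq-04013).
* `ledger negatives --problem QuantumFields` (5 entries: RobustYangMillsRG stmt-14958, MirrorModularBoosts
  stmt-9665, AdaptiveCoarseSystem stmt-9494, MultibosonLatticeGap stmt-9599, AdmissibleRootsExist stmt-9603) —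
  none concerns classical spin systems / the principal chiral model; lessons applied: no hand-picked constant
  (all thresholds and rates existential, typing checklist 4c (iv)); every stub is a VERBATIM sub-formula of the
  crux over named copies of the crux's own objects (no bespoke predicate a witness could exploit).
* Junk values: `pcmExpect` divides by `(μ univ).toReal`; `μ` = product Haar on the compact `SU(N)^{(ℤ/L)⁴}` with
  the bounded, strictly positive density `exp(β Σ Re tr g g'† + h Σ Re tr g)`, so `0 < μ univ < ∞` and `E` is an
  honest normalised expectation (no `0/0`); the `Measurable F` binders of the upper law are the crux's own
  (checklist 4c (ii)); the lower law is stated for `4·dist 0 y ≤ L` exactly as in the crux.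

## BC3 probes (planner folder `bc/`, 2026-08-17; raw outputs in NOTES.md and `Lines/birth.md`)
For each stub statement `S ∈ {UpperClustering 2, TransverseLower 2, UpperClustering 3, TransverseLower 3}`:
`example : S → SpinWaveLaws` and `example : S → QCD` by `exact?`, by `intro h; simpa using h` and by `aesop`
(separately, `maxHeartbeats 400000`): 24/24 FAIL (rc 1: "`exact?` could not close the goal" / "Type mismatch …
has type S but is expected to have type SpinWaveLaws|QCD" / "unsolved goals ⊢ SpinWaveLaws|QCD", aesop exhaustive
search failed); the combined `first | exact? | simpa [S] | (unfold S; simpa) | aesop` variants: 8/8 FAIL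
(deterministic timeouts at 400000 heartbeats).  No stub is cheaply the crux (each is one target × one side) or
the summit.
-/

noncomputable section

namespace Summit.QuantumFields.QCD.Cruxes.SpinWaveLaws.Birth

open scoped BigOperators Topology Manifold Classical MeasureTheory ProbabilityTheory Matrix InnerProductSpace ComplexConjugate ContinuousMap
open Filter Set Function TopologicalSpace MeasureTheory
open Literature.MathematicalPhysics.QuantumFieldTheory (haarProbability)
open Literature.Probability.LatticeModels (TorusSite)
open Summit.QuantumFields.QCD.Theses.ChiralSpinWaves (SpinWaveLaws)

/-! ## §0 Currency — the crux's inlined `let`s, verbatim, as named definitions -/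

/-- The target group `SU(N) ⊂ M_N(ℂ)` (the crux's `G`). -/
abbrev SU (N : ℕ) : Type := ↥(Matrix.specialUnitaryGroup (Fin N) ℂ)

/-- Sup-distance on the torus `(ℤ/L)⁴` (verbatim the crux's `dist`). -/
def torusDist {L : ℕ} (a b : TorusSite 4 L) : ℕ :=
  Finset.univ.sup fun i : Fin 4 => ((a i - b i).valMinAbs).natAbs

/-- The Boltzmann weight of the SU(N) principal chiral model at stiffness `β` in the field `h`
(verbatim the crux's `w`): `exp(β Σ_x Σ_μ Re tr(g_x g_{x+μ}†) + h Σ_x Re tr g_x)`. -/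
def pcmWeight (N : ℕ) (β h : ℝ) (L : ℕ) [NeZero L] (g : TorusSite 4 L → SU N) : ℝ :=
  Real.exp (β * ∑ x : TorusSite 4 L, ∑ i : Fin 4,
      (((g x : Matrix (Fin N) (Fin N) ℂ) *
        ((g (x + Pi.single i 1) : Matrix (Fin N) (Fin N) ℂ)).conjTranspose).trace).re +
    h * ∑ x : TorusSite 4 L, ((g x : Matrix (Fin N) (Fin N) ℂ).trace).re)

/-- The (unnormalised) Gibbs measure of the model: product Haar with density `pcmWeight`
(verbatim the crux's `μ`). -/
def pcmMeasure (N : ℕ) (β h : ℝ) (L : ℕ) [NeZero L] : Measure (TorusSite 4 L → SU N) :=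
  (Measure.pi fun _ : TorusSite 4 L => haarProbability (SU N)).withDensity
    fun g => ENNReal.ofReal (pcmWeight N β h L g)

/-- The normalised expectation `E F = (∫ F dμ) / μ(univ)` (verbatim the crux's `E`). -/
def pcmExpect (N : ℕ) (β h : ℝ) (L : ℕ) [NeZero L] (F : (TorusSite 4 L → SU N) → ℝ) : ℝ :=
  (∫ g, F g ∂pcmMeasure N β h L) / (pcmMeasure N β h L Set.univ).toReal

/-- The transverse (pion) coordinate `u(g) = Im g₀₁` (verbatim the crux's `u`; needs `2 ≤ N`). -/
def transverse {N : ℕ} (hN : 2 ≤ N) (g : SU N) : ℝ :=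
  ((g : Matrix (Fin N) (Fin N) ℂ) ⟨0, by omega⟩ ⟨1, by omega⟩).im

/-! ## §1 The two one-sided laws at a fixed target `SU(N)` -/

/-- **UPPER LAW at `SU(N)`** — exponential clustering at the spin-wave mass, all bounded cylinder observables,
uniformly in the volume: there are `β₀, h₀, c > 0`, `K : ℕ → ℕ → ℝ`, `L₀` such that for `β ≥ β₀`,
`0 < h ≤ h₀`, `L ≥ L₀`, and `F, F'` measurable, bounded by `1`, determined by the spins in `A`, `B` at torus
sup-distance `≥ R`: `|E(F F') − E F · E F'| ≤ K(|A|,|B|) · exp(−c √(h/β) R)`.  (The first conjunct of the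
crux at this `N`, with its own thresholds.) -/
def UpperClustering (N : ℕ) : Prop :=
  ∃ β₀ h₀ c : ℝ, 0 < β₀ ∧ 0 < h₀ ∧ 0 < c ∧ ∃ (K : ℕ → ℕ → ℝ) (L₀ : ℕ),
    ∀ (β h : ℝ), β₀ ≤ β → 0 < h → h ≤ h₀ → ∀ (L : ℕ) [NeZero L], L₀ ≤ L →
      ∀ (A B : Finset (TorusSite 4 L)) (F F' : (TorusSite 4 L → SU N) → ℝ),
        (∀ g g', (∀ x ∈ A, g x = g' x) → F g = F g') → (∀ g g', (∀ x ∈ B, g x = g' x) → F' g = F' g') →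
          Measurable F → Measurable F' → (∀ g, |F g| ≤ 1) → (∀ g, |F' g| ≤ 1) →
            ∀ R : ℕ, (∀ a ∈ A, ∀ b ∈ B, R ≤ torusDist a b) →
              |pcmExpect N β h L (fun g => F g * F' g) - pcmExpect N β h L F * pcmExpect N β h L F'| ≤
                K A.card B.card * Real.exp (-(c * Real.sqrt (h / β) * R))

/-- **LOWER (TRANSVERSE) LAW at `SU(N)`** — the Goldstone mode propagates: there are `β₀, h₀, C, c' > 0`, `L₀`
such that for `β ≥ β₀`, `0 < h ≤ h₀`, `L ≥ L₀` and every site `y` with `4·dist(0,y) ≤ L`: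
`Cov(u(g_0), u(g_y)) ≥ (c'/β) (1 + dist(0,y))⁻² exp(−C √(h/β) dist(0,y))`, `u = Im g₀₁`.  (The second
conjunct of the crux at this `N`, with its own thresholds; `2 ≤ N` is the crux's own index guard.) -/
def TransverseLower (N : ℕ) : Prop :=
  ∀ hN : 2 ≤ N, ∃ β₀ h₀ C c' : ℝ, 0 < β₀ ∧ 0 < h₀ ∧ 0 < C ∧ 0 < c' ∧ ∃ L₀ : ℕ,
    ∀ (β h : ℝ), β₀ ≤ β → 0 < h → h ≤ h₀ → ∀ (L : ℕ) [NeZero L], L₀ ≤ L →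
      ∀ y : TorusSite 4 L, 4 * torusDist 0 y ≤ L →
        c' / β / ((1 : ℝ) + torusDist 0 y) ^ 2 * Real.exp (-(C * Real.sqrt (h / β) * torusDist 0 y)) ≤
          pcmExpect N β h L (fun g => transverse hN (g 0) * transverse hN (g y)) -
            pcmExpect N β h L (fun g => transverse hN (g 0)) * pcmExpect N β h L (fun g => transverse hN (g y))

/-- **The crux body at a fixed `N`** — VERBATIM the body of `ChiralSpinWaves.SpinWaveLaws` under its binders
`N`, `hN : 2 ≤ N` (so that `SpinWaveLaws` is definitionally `∀ N, N = 2 ∨ N = 3 → ∀ hN, LawsAt N hN`). -/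
def LawsAt (N : ℕ) (hN : 2 ≤ N) : Prop :=
  ∃ β₀ h₀ c C c' : ℝ, 0 < β₀ ∧ 0 < h₀ ∧ 0 < c ∧ 0 < C ∧ 0 < c' ∧ ∃ (K : ℕ → ℕ → ℝ) (L₀ : ℕ), ∀ (β h : ℝ), β₀ ≤ β → 0 < h → h ≤ h₀ → ∀ (L : ℕ) [NeZero L], L₀ ≤ L → let G := Matrix.specialUnitaryGroup (Fin N) ℂ; let dist : TorusSite 4 L → TorusSite 4 L → ℕ := fun a b => Finset.univ.sup fun i : Fin 4 => ((a i - b i).valMinAbs).natAbs; let w : (TorusSite 4 L → G) → ℝ := fun g => Real.exp (β * ∑ x : TorusSite 4 L, ∑ i : Fin 4, (((g x : Matrix (Fin N) (Fin N) ℂ) * ((g (x + Pi.single i 1) : Matrix (Fin N) (Fin N) ℂ)).conjTranspose).trace).re + h * ∑ x : TorusSite 4 L, ((g x : Matrix (Fin N) (Fin N) ℂ).trace).re); let μ : Measure (TorusSite 4 L → G) := (Measure.pi fun _ : TorusSite 4 L => haarProbability G).withDensity fun g => ENNReal.ofReal (w g); let E : ((TorusSite 4 L → G) → ℝ) → ℝ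 := fun F => (∫ g, F g ∂μ) / (μ Set.univ).toReal; let u : G → ℝ := fun g => ((g : Matrix (Fin N) (Fin N) ℂ) ⟨0, by omega⟩ ⟨1, by omega⟩).im; (∀ (A B : Finset (TorusSite 4 L)) (F F' : (TorusSite 4 L → G) → ℝ), (∀ g g', (∀ x ∈ A, g x = g' x) → F g = F g') → (∀ g g', (∀ x ∈ B, g x = g' x) → F' g = F' g') → Measurable F → Measurable F' → (∀ g, |F g| ≤ 1) → (∀ g, |F' g| ≤ 1) → ∀ R : ℕ, (∀ a ∈ A, ∀ b ∈ B, R ≤ dist a b) → |E (fun g => F g * F' g) - E F * E F'| ≤ K A.card B.card * Real.exp (-(c * Real.sqrt (h / β) * R))) ∧ (∀ y : TorusSite 4 L, 4 * dist 0 y ≤ L → c' / β / ((1 : ℝ) + dist 0 y) ^ 2 * Real.exp (-(C * Real.sqrt (h / β) * dist 0 y)) ≤ E (fun g => u (g 0) * u (g y)) - E (fun g => u (g 0)) * E (fun g => u (g y)))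

/-! ## §2 The registered stubs (the ONLY `sorry`s of this file) -/

/-- **(S1) SU(2) = S³, upper law** — the O(4) nonlinear σ-model (`Re tr(g h†) = 2⟨s, s'⟩` on unit
quaternions) on `(ℤ/L)⁴` in a field: exponential clustering of bounded cylinder observables at rate
`c √(h/β)`, uniformly in the volume, for `β ≥ β₀` and ALL `0 < h ≤ h₀`.  Size XL.  Why plausibly true: the
model is in the class of Bałaban's low-temperature expansion (N-vector, d ≥ 3, small field), whose effective
Gaussian at every scale is massive with mass² `≍ h/β`.  Why it might fail: the printed expansions are on `ℤ^d`
with `h → 0⁺` AFTER the thermodynamic limit; uniformity of `K, c` down to `h → 0⁺` at fixed `β` on TORI is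
unverified (Balaban1995, Balaban1996, Balaban1998; GiulianiOtt2023 §1). -/
theorem stub_su2UpperClustering : UpperClustering 2 := by
  sorry

/-- **(S2) SU(2) = S³, lower (transverse) law** — the pion propagates in the O(4) model: the transverse
two-point function `Cov(Im (g_0)₀₁, Im (g_y)₀₁)` is bounded below by `(c'/β)(1+|y|)⁻² exp(−C √(h/β) |y|)`
out to a quarter of the torus.  Size L–XL.  Why plausibly true: tree level gives `(1/2β)·(−Δ + h/β)⁻¹(0,y)`,
which dominates the stated profile for `C ≥ 2`; `E u = 0` by the symmetry `g ↦ ḡ` of weight and Haar, so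
the covariance is the plain two-point function; reflection positivity makes the axis two-point function a
positive Laplace transform, the axial Ward identity pins the transverse susceptibility `Σ_y ⟨u_0 u_y⟩` to a
local longitudinal expectation divided by `h`, and Bałaban–O'Carroll control the asymptotics.  Why it might
fail: positivity of the transverse correlator at ALL sites (off-axis, intermediate distances) is not a
consequence of RP alone, and no Griffiths/Ginibre inequality is known for S³-valued spins (BalabanOcarroll1999,
FrohlichSimonSpencer1976, GiulianiOtt2023). -/
theorem stub_su2TransverseLower : TransverseLower 2 := by
  sorry

/-- **(S3) SU(3), upper law** — the genuinely group-valued principal chiral model: the same clustering law.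
Size XL (open).  Why plausibly true: at low temperature the field fluctuates near the identity up to a global
rotation, the quadratic form is `(β/4)[θ·(−Δ)θ + (h/β)|θ|²]` on `su(3)`, and Bałaban's multiscale scheme is
target-agnostic in outline.  Why it might fail: the expansion has never been built for a non-spherical target;
large-field regions carry `π₃(SU(3)) = ℤ` textures whose entropy must be beaten uniformly in `h → 0⁺`
(Balaban1998; BalabanOcarroll1999). -/
theorem stub_su3UpperClustering : UpperClustering 3 := by
  sorry

/-- **(S4) SU(3), lower (transverse) law** — the same spin-wave lower bound for `u(g) = Im g₀₁` in the SU(3)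
model.  Size XL (open).  Why plausibly true / fail: as (S2), plus the rebuild of (S3); the transverse channel
`u = Im g₀₁` is one `su(3)` generator direction (`E u = 0` by `g ↦ ḡ`, or by `g ↦ V g V†` with
`V = diag(i, −i, 1)`, both symmetries of weight and Haar), and its tree-level propagator is again
`(1/2β)(−Δ + h/β)⁻¹`; positivity at all sites is the open point. -/
theorem stub_su3TransverseLower : TransverseLower 3 := by
  sorry

/-! ## §3 Composition (kernel-checked; no `sorry` below this line) -/

/-- **Merging the two one-sided laws at a fixed target** (pure bookkeeping, proved): thresholds
`β₀ := max`, `h₀ := min`, `L₀ := max`; the named currency of §0 is definitionally the crux's inlined `let`s.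
[folklore] -/
theorem lawsAt_of_upper_of_lower (N : ℕ) (hN : 2 ≤ N) (hU : UpperClustering N) (hL : TransverseLower N) :
    LawsAt N hN := by
  obtain ⟨β₁, h₁, c, hβ₁, hh₁, hc, K, L₁, HU⟩ := hU
  obtain ⟨β₂, h₂, C, c', hβ₂, hh₂, hC, hc', L₂, HL⟩ := hL hN
  refine ⟨max β₁ β₂, min h₁ h₂, c, C, c', lt_max_of_lt_left hβ₁, lt_min hh₁ hh₂, hc, hC, hc', K, max L₁ L₂,
    ?_⟩
  intro β h hβ hh hhh L _ hLge
  dsimp only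
  refine ⟨fun A B F F' hFA hFB hFm hF'm hF1 hF'1 R hR => ?_, fun y hy => ?_⟩
  · exact HU β h ((le_max_left _ _).trans hβ) hh (hhh.trans (min_le_left _ _)) L ((le_max_left _ _).trans hLge)
      A B F F' hFA hFB hFm hF'm hF1 hF'1 R hR
  · exact HL β h ((le_max_right _ _).trans hβ) hh (hhh.trans (min_le_right _ _)) L
      ((le_max_right _ _).trans hLge) y hy

/-! ### The stub SIGNATURES keyed by stub name

Each stub's statement is ALSO recorded as the `Prop` `__Registered.stub_<name>` (an `abbrev`, `rfl`-equal to
the statement of the registered `theorem stub_<name>` above), so that the composition `SpinWaveLaws_of` takes the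
four statements as hypotheses whose heads are NAMED like the declared stubs (layer-invariant skeleton audit; device
of `Parity/…/Cruxes/MobiusCofactorAtom/Lines/birth.lean`, `FinalStateConjecture/…/OmegaLimitMultiKerr/Lines/birth.lean`).
The `__` namespace is an implementation detail, so the audit's stub report resolves each `stub_…` to the sorried
theorem, not to its alias; the gate-reserved `@[stub]` attribute is not written by a planner. -/
namespace __Registered

/-- Alias of `UpperClustering 2` keyed by the registered stub name. -/
abbrev stub_su2UpperClustering : Prop := UpperClustering 2
/-- Alias of `TransverseLower 2` keyed by the registered stub name. -/
abbrev stub_su2TransverseLower : Prop := TransverseLower 2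
/-- Alias of `UpperClustering 3` keyed by the registered stub name. -/
abbrev stub_su3UpperClustering : Prop := UpperClustering 3
/-- Alias of `TransverseLower 3` keyed by the registered stub name. -/
abbrev stub_su3TransverseLower : Prop := TransverseLower 3

end __Registered

/-- **The crux from the four stubs** (concludes `SpinWaveLaws` BY NAME): case on `N ∈ {2, 3}`, then merge the
two one-sided laws of that target (`lawsAt_of_upper_of_lower`; `LawsAt N hN` is the crux body verbatim). -/
theorem SpinWaveLaws_of :
    __Registered.stub_su2UpperClustering → __Registered.stub_su2TransverseLower →
      __Registered.stub_su3UpperClustering → __Registered.stub_su3TransverseLower → SpinWaveLaws := by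
  intro hU2 hL2 hU3 hL3 N hN23 hN
  rcases hN23 with rfl | rfl
  · exact lawsAt_of_upper_of_lower 2 hN hU2 hL2
  · exact lawsAt_of_upper_of_lower 3 hN hU3 hL3

/-- The crux along this skeleton, from the registered stubs (sorries only inside `stub_*`). -/
theorem spinWaveLaws_of_stubs : SpinWaveLaws :=
  SpinWaveLaws_of stub_su2UpperClustering stub_su2TransverseLower stub_su3UpperClustering
    stub_su3TransverseLower

end Summit.QuantumFields.QCD.Cruxes.SpinWaveLaws.Birth

end
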